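import Literature.AnabelianGeometry.SemiGraphs.ArithDecompositionData
import HarnessLib

/-!
# [SemiAnbd] Def 5.3 (ii) / Thm 5.4: total arithmetic estrangement of the PRODUCED decomposition data is
# NOT invariant under change of the chosen §3 representatives (kernel certificate of a design datum)

Mochizuki, *Semi-graphs of anabelioids*, Publ. RIMS **42** (2006) 221–322, §5 Def 5.3 (ii) p. 65 ("for
every vertex `v` to which some branch `b` of `e` abuts and every `g ∈ Π^temp_{𝔊,v}`, the intersection in
`Π^temp_{𝔊,v}` of `Π^temp_{𝔊,b}` with any subgroup of the form `g · Π^temp_{𝔊,b'} · g⁻¹`, where either `b' ≠ b` is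
a branch of an edge that abuts to `v` or `b' = b` and `g ∉ Π^temp_{𝔊,b}`, fails to be arithmetically ample"),
Rmk 5.3.1 p. 65 ("all verticial and edge-like subgroups … are … arithmetically ample"), Thm 5.4 p. 66
(hypothesis "totally arithmetically estranged"). [cite: MochizukiSemiAnbd2006, Def 5.3 (ii), p. 65]

PROOF-ONLY companion (abc-iut cell, layer L3, sub-DAG `plan/L3/SUBDAG-SemiAnbd-Thm54.md`; row
«T54·Rc-INVARIANCE», seat abc-iut-w4-d089 gen 7, file 3: the DESIGN DATUM for the statement-level half of
the row).  No definition, no new named fact.  The CONCLUSIONS of Thm 5.4 (i)/(ii) for the produced data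
`decompositionDataOfChart Rc ι` (abc-iut-w4-d053) see the data only through the notions verticial /
edge-like, which are independent of `Rc : ChartRepresentatives c` (`isVerticial_decompositionDataOfChart_iff`;
`ArithBrGpOfCommensuratorGrowth.lean`, `ArithEdgeLikeOfChartRepresentatives.lean`).  The HYPOTHESIS "totally
arithmetically estranged" (`IsTotallyArithEstranged`, Def 5.3 (ii)) is different: clause (A) reads the chosen
representatives themselves, and the tree's `ChartRepresentatives` (compatibility `Hb b ≤ Hv v` only) admits,
at a LOOP edge `e` with branches `b₁ ≠ b₂` at the vertex `v`, the DEGENERATE choice `Hb b₂ := Hb b₁` — whereas in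
print `Π^temp_{𝔊,b₁}`, `Π^temp_{𝔊,b₂}` are distinct `Π^temp_{𝔊,v}`-classes.  At such a choice the produced branch
groups coincide and clause (A) at `(b₁, v, g := 1, b' := b₂)` demands that `Π^temp_{𝔊,b₁}` itself fail to be
arithmetically ample, contradicting Rmk 5.3.1:

* `ChartRepresentatives.exists_Hb_eq` — the degenerate choice exists (same edge, same vertex);
* `arithBrGp_congr` / `arithBrGp_eq_of_Hb_eq` — bookkeeping;
* **`not_isTotallyArithEstranged_of_Hb_eq`** — `Hb b₂ = Hb b₁` for `b₁ ≠ b₂` at `v` and `Π^temp_{𝔊,b₁}`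
  arithmetically ample ⇒ the produced data are NOT totally arithmetically estranged;
* **`exists_chartRepresentatives_not_isTotallyArithEstranged`** — hence at every loop edge there are
  representatives `Rc'`, agreeing with `Rc` at all vertices and at `b₁`, whose produced data are not totally
  arithmetically estranged (given the ampleness of `Π^temp_{𝔊,b₁}`, e.g. from Rmk 5.3.1 first sentence:
  `…_of_verticialEdgeLikeCompactAmple`).

CONSEQUENCE FOR THE ROW (no landed theorem is affected — all of them bind `hest` at the same `Rc` as their
conclusion): a Thm 5.4 (i)/(ii) theorem "for every `Rc`" must bind `hest` at the MATCHED representatives read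
off the presentation (or carry a non-degeneracy side condition on `Rc`); the conclusion is then transported to
every `Rc` by the invariance of the two notions.  Nothing here takes a side on [IUTchIII] Cor. 3.12; typed ≠
proved for Thm 5.4 itself.
-/

namespace Literature.AnabelianGeometry.SemiGraphs

namespace ProfiniteSemiGraph

open scoped Pointwise

universe u u' u''

variable {𝒢 : ProfiniteSemiGraph.{u}} {c : TemperedPiChart 𝒢} {Gtp : Type u'} [Group Gtp]

/-! ### Degenerate representatives at a loop edge -/

/-- **The degenerate choice exists**: for branches `b₁`, `b₂` of the same edge abutting to the same vertex
(a loop), replacing `Hb b₂` by `Hb b₁` is again a compatible choice of §3 representatives (same edge: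
`Hb_mem`; same vertex: `Hb_le`). [cite: MochizukiSemiAnbd2006, §5, p. 65] -/
theorem ChartRepresentatives.exists_Hb_eq (R : ChartRepresentatives c) {b₁ b₂ : 𝒢.graph.Branch}
    (he : 𝒢.graph.edgeOf b₂ = 𝒢.graph.edgeOf b₁) (hv : 𝒢.graph.abuts b₂ = 𝒢.graph.abuts b₁) :
    ∃ R' : ChartRepresentatives c, R'.Hv = R.Hv ∧ R'.Hb b₂ = R.Hb b₁ ∧ ∀ b, b ≠ b₂ → R'.Hb b = R.Hb b := by
  classical
  refine ⟨⟨R.Hv, R.Hv_mem, Function.update R.Hb b₂ (R.Hb b₁), fun b => ?_, fun b v h => ?_⟩, rfl,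
    show Function.update R.Hb b₂ (R.Hb b₁) b₂ = R.Hb b₁ from Function.update_self ..,
    fun b hb => show Function.update R.Hb b₂ (R.Hb b₁) b = R.Hb b from Function.update_of_ne hb ..⟩
  · by_cases hb : b = b₂
    · subst hb
      rw [Function.update_self, he]
      exact R.Hb_mem b₁
    · rw [Function.update_of_ne hb]
      exact R.Hb_mem b
  · by_cases hb : b = b₂
    · subst hb
      rw [Function.update_self]
      exact R.Hb_le b₁ v (hv ▸ h)
    · rw [Function.update_of_ne hb]
      exact R.Hb_le b v h

/-! ### Bookkeeping: the produced groups only read `Hv`, `Hb` -/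

/-- Representatives with the same vertex choices produce the same vertex groups.
[cite: MochizukiSemiAnbd2006, §5, p. 65] -/
theorem arithVertGp_congr {R R' : ChartRepresentatives c} (ι : c.G →* Gtp) (hV : R'.Hv = R.Hv) :
    arithVertGp R' ι = arithVertGp R ι := by
  funext v
  rw [arithVertGp, arithVertGp, hV]

/-- … and, at a branch with the same branch choice, the same branch group.
[cite: MochizukiSemiAnbd2006, §5, p. 65] -/
theorem arithBrGp_congr {R R' : ChartRepresentatives c} (ι : c.G →* Gtp) (hV : R'.Hv = R.Hv)
    {b : 𝒢.graph.Branch} (hb : R'.Hb b = R.Hb b) : arithBrGp R' ι b = arithBrGp R ι b := by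
  rw [arithBrGp, arithBrGp, arithVertGp_congr ι hV, hb]

/-- At a degenerate choice (`Hb b₂ = Hb b₁`, same vertex) the produced branch groups of `b₁` and `b₂`
COINCIDE. [cite: MochizukiSemiAnbd2006, §5, p. 65] -/
theorem arithBrGp_eq_of_Hb_eq (R : ChartRepresentatives c) (ι : c.G →* Gtp) {b₁ b₂ : 𝒢.graph.Branch}
    (hHb : R.Hb b₂ = R.Hb b₁) (hv : 𝒢.graph.abuts b₂ = 𝒢.graph.abuts b₁) :
    arithBrGp R ι b₂ = arithBrGp R ι b₁ := by
  rw [arithBrGp, arithBrGp, hHb, hv]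

/-- `1 · K · 1⁻¹ = K`. [folklore] -/
private theorem conjSubgroup_one_eq' (K : Subgroup Gtp) : conjSubgroup (1 : Gtp) K = K := by
  ext x; simp [conjSubgroup]

/-! ### The certificate -/

variable {PA : Type u''} [Group PA] [TopologicalSpace PA]

/-- **Degenerate representatives are never totally arithmetically estranged** (given Rmk 5.3.1's ampleness
of `Π^temp_{𝔊,b₁}`): with `Hb b₂ = Hb b₁` for distinct branches `b₁ ≠ b₂` abutting to `v`, clause (A) of
Def 5.3 (ii) at `(e(b₁), b₁, v, g := 1, b' := b₂)` reads "`Π^temp_{𝔊,b₁} ∩ Π^temp_{𝔊,b₁}` is not arithmetically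
ample". [cite: MochizukiSemiAnbd2006, Def 5.3 (ii), p. 65] -/
theorem not_isTotallyArithEstranged_of_Hb_eq (R : ChartRepresentatives c) (ι : c.G →* Gtp)
    (aug : Gtp →* PA) {b₁ b₂ : 𝒢.graph.Branch} {v : 𝒢.graph.Vertex} (hne : b₁ ≠ b₂)
    (h₁ : 𝒢.graph.abuts b₁ = some v) (h₂ : 𝒢.graph.abuts b₂ = some v) (hHb : R.Hb b₂ = R.Hb b₁)
    (hample : IsArithAmple aug (arithBrGp R ι b₁)) :
    ¬ IsTotallyArithEstranged (decompositionDataOfChart R ι) aug := by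
  intro hest
  have h := (hest (𝒢.graph.edgeOf b₁) b₁ rfl v h₁ 1 (one_mem _)).1 b₂ h₂ (Ne.symm hne)
  apply h
  change IsArithAmple aug (arithBrGp R ι b₁ ⊓ conjSubgroup 1 (arithBrGp R ι b₂))
  rw [arithBrGp_eq_of_Hb_eq R ι hHb (h₂.trans h₁.symm), conjSubgroup_one_eq', inf_idem]
  exact hample

/-- **Total arithmetic estrangement of the produced data is NOT invariant under change of representatives**:
at a loop edge (`b₁ ≠ b₂`, same edge, same vertex `v`) with `Π^temp_{𝔊,b₁}` arithmetically ample there are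
representatives `Rc'` — equal to `Rc` at every vertex and at `b₁` — whose produced data fail Def 5.3 (ii).
[cite: MochizukiSemiAnbd2006, Def 5.3 (ii), p. 65] -/
theorem exists_chartRepresentatives_not_isTotallyArithEstranged (R : ChartRepresentatives c)
    (ι : c.G →* Gtp) (aug : Gtp →* PA) {b₁ b₂ : 𝒢.graph.Branch} {v : 𝒢.graph.Vertex} (hne : b₁ ≠ b₂)
    (he : 𝒢.graph.edgeOf b₂ = 𝒢.graph.edgeOf b₁) (h₁ : 𝒢.graph.abuts b₁ = some v)
    (h₂ : 𝒢.graph.abuts b₂ = some v) (hample : IsArithAmple aug (arithBrGp R ι b₁)) :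
    ∃ R' : ChartRepresentatives c, R'.Hv = R.Hv ∧ R'.Hb b₁ = R.Hb b₁ ∧
      ¬ IsTotallyArithEstranged (decompositionDataOfChart R' ι) aug := by
  obtain ⟨R', hV, hB, hother⟩ := R.exists_Hb_eq he (h₂.trans h₁.symm)
  have hb₁ : R'.Hb b₁ = R.Hb b₁ := hother b₁ hne
  refine ⟨R', hV, hb₁, not_isTotallyArithEstranged_of_Hb_eq R' ι aug hne h₁ h₂ (hB.trans hb₁.symm) ?_⟩
  rw [arithBrGp_congr ι hV hb₁]
  exact hample

/-- The same with the ampleness of `Π^temp_{𝔊,b₁}` supplied by Rmk 5.3.1's first sentence for the produced data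
at `Rc` (the typed `VerticialEdgeLikeCompactAmpleStatement`, binder `hR` of the Thm 5.4 (ii) assembly): so the
two hypotheses `hR` and `hest` of the assembly, read at ALL representatives at once, are jointly
unsatisfiable at a graph with a loop — they must be bound at matched representatives.
[cite: MochizukiSemiAnbd2006, Def 5.3 (ii) / Rmk 5.3.1, p. 65] -/
theorem exists_chartRepresentatives_not_isTotallyArithEstranged_of_verticialEdgeLikeCompactAmple
    [TopologicalSpace Gtp] (R : ChartRepresentatives c) (ι : c.G →* Gtp) (aug : Gtp →* PA)
    {b₁ b₂ : 𝒢.graph.Branch}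
    {v : 𝒢.graph.Vertex} (hne : b₁ ≠ b₂) (he : 𝒢.graph.edgeOf b₂ = 𝒢.graph.edgeOf b₁)
    (h₁ : 𝒢.graph.abuts b₁ = some v) (h₂ : 𝒢.graph.abuts b₂ = some v)
    (hR : VerticialEdgeLikeCompactAmpleStatement (decompositionDataOfChart R ι) aug) :
    ∃ R' : ChartRepresentatives c, R'.Hv = R.Hv ∧ R'.Hb b₁ = R.Hb b₁ ∧
      ¬ IsTotallyArithEstranged (decompositionDataOfChart R' ι) aug :=
  exists_chartRepresentatives_not_isTotallyArithEstranged R ι aug hne he h₁ h₂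
    (hR (arithBrGp R ι b₁) (Or.inr ⟨b₁, 1, (conjSubgroup_one_eq' _).symm⟩)).2

/-- Hence "totally arithmetically estranged" does NOT transfer across representatives: it is not the case
that `hest` at one choice implies `hest` at every choice (at a graph with a loop edge whose branch group is
arithmetically ample at some totally arithmetically estranged choice). [cite: MochizukiSemiAnbd2006, Def 5.3 (ii), p. 65] -/
theorem not_forall_isTotallyArithEstranged_transfer (R : ChartRepresentatives c) (ι : c.G →* Gtp)
    (aug : Gtp →* PA) {b₁ b₂ : 𝒢.graph.Branch} {v : 𝒢.graph.Vertex} (hne : b₁ ≠ b₂)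
    (he : 𝒢.graph.edgeOf b₂ = 𝒢.graph.edgeOf b₁) (h₁ : 𝒢.graph.abuts b₁ = some v)
    (h₂ : 𝒢.graph.abuts b₂ = some v) (hample : IsArithAmple aug (arithBrGp R ι b₁))
    (hest : IsTotallyArithEstranged (decompositionDataOfChart R ι) aug) :
    ¬ ∀ R₁ R₂ : ChartRepresentatives c, IsTotallyArithEstranged (decompositionDataOfChart R₁ ι) aug →
      IsTotallyArithEstranged (decompositionDataOfChart R₂ ι) aug := by
  intro hall
  obtain ⟨R', -, -, hR'⟩ := exists_chartRepresentatives_not_isTotallyArithEstranged R ι aug hne he h₁ h₂ hample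
  exact hR' (hall R R' hest)

end ProfiniteSemiGraph

end Literature.AnabelianGeometry.SemiGraphs
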